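import Summits.Ventures.KdS.RouteWSpinFlipStrata
import Summits.Ventures.KdS.RouteWRealAxis
import HarnessLib

/-!
# Venture KdS — the REAL AXIS for spins `s ≥ 1/2`: the Teukolsky–Starobinsky flip off the
# cosmological lattice, and the formal Euler partner on its bottom stratum

HONEST FRAMING (venture `Summits/Ventures/KdS`, cell `pub-kds`, LIT-1 g23 under lead ruling A91,
"T4"). Nothing here is a claim about the Final State Conjecture or about nonlinear stability; this is
tree-debt reduction towards the cited Literature fact `CasalsTeixeiraDaCosta2022_theorem310`
([CasalsTeixeiradacosta2022, Theorem 3.10] verbatim with Definition 3.4's `ω ≠ 0`), whose real-axis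
bullet the venture had proved only for `s < 1` (`RouteW.realAxis_vanishing_lt_one`,
`RouteWRealAxis.lean`). File 1 of 2 (file 2: `RouteWRealAxisHighSpin.lean`).

WHAT IS PROVED (0 cited facts, 0 sorries):
* `realAxis_vanishing_offLattice` — `s = N/2 ≥ 1/2`, `ω ∈ ℝ∖{0}`, `Im λ̄ = 0`,
  `m = 0 ∨ ω/m ∉ (Ω_low, Ω_SR)`, OFF the cosmological lattice (`OffLattice`): the
  Teukolsky–Starobinsky image (`spinFlipTS_holds`, valid for EVERY `ω`) has spin `−s < 1` and the
  same `λ̄` (`lambdaBar_lamFlip`), so the landed `realAxis_vanishing_lt_one` kills it and the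
  off-lattice injectivity returns `R ≡ 0`.
* `realAxis_vanishing_lattice` — ON the lattice (`s + 2B(r_c) = j ∈ ℕ`, `j + 1 ≤ N`; at a real
  frequency this is the bottom stratum `j = s ∈ ℤ_{≥1}`, `Re ω = mϖ₂`), with `Re ω ≠ mϖ₁`: the proof
  of `radial_vanishing_lattice` (`RouteWSpinFlipStrata.lean`, LIT-1 g22) VERBATIM, its two
  `Im ω > 0` steps replaced by their landed real-axis counterparts — `realAxis_vanishing_lt_one` for
  the flipped solution and `swappedRealAxisVanishing_holds` (CTdC Thm 3.10, Step 2 at `Im ω = 0`,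
  `RouteWRealAxis.lean`) for the formal Euler partner `Σ b_k (w−1)^{2(η₀+η₁)+k}`; the resonance
  exclusions need only `Re ω ≠ mϖ₁` (`ρ + 1 + i ≠ 0`) and Prop. 3.8's `p₃`, which is automatic at a
  real frequency (`Re η_j = 0`).
-/

noncomputable section

open Set Complex Filter Topology Finset Polynomial

namespace Summit.Ventures.KdS

namespace RouteW

open Literature.Analysis.ODE Literature.Analysis.ODE.GeneralHeun
open Literature.Geometry.Lorentzian Literature.Geometry.Lorentzian.KerrDeSitter
open SpinFlipTS

/-! ### The real axis off the cosmological lattice, `s ≥ 1/2` -/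

/-- **Real axis, off the lattice.** For `s = N/2 ≥ 1/2`, `ω ∈ ℝ∖{0}`, `Im λ̄ = 0`,
`m = 0 ∨ ω/m ∉ (Ω_low, Ω_SR)` and `OffLattice`: the Teukolsky–Starobinsky image (spin `−s < 1`, same
`λ̄`) vanishes by `realAxis_vanishing_lt_one`, hence so does `R` (`spinFlipTS_holds`, any `ω`).
[cite: CasalsTeixeiradacosta2022, Theorem 3.10 (second bullet) with Corollary 3.9 (i)⇔(ii)] -/
theorem realAxis_vanishing_offLattice {M a Λ s : ℝ} {ω : ℂ} {m : ℝ} {lam : ℂ} {R : ℝ → ℂ}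
    (hsub : IsSubextremal M a Λ) (ha : 0 ≤ a) {N : ℕ} (hN1 : 1 ≤ N) (hsN : 2 * s = N)
    (hω : ω.im = 0) (hω0 : ω ≠ 0) (hlam : (lambdaBar a Λ s ω m lam).im = 0)
    (hthird : m = 0 ∨
      ¬(superradiantLower M a Λ < ω.re / m ∧ ω.re / m < superradiantUpper M a Λ))
    (hoff : OffLattice M a Λ s ω m)
    (hR : IsRadialTeukolskySolution M a Λ s ω m lam R) (hin : IsIngoingAtEventHorizon M a Λ s ω m R)
    (hout : IsOutgoingAtCosmoHorizon M a Λ ω m R) :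
    ∀ r ∈ Ioo (rPlus M a Λ) (rCosmo M a Λ), R r = 0 := by
  obtain ⟨R', hR', hin', hout', hinj⟩ := spinFlipTS_holds M a Λ s ω m lam R N hsub hN1 hsN hR hin hout
  have hN' : (1 : ℝ) ≤ N := by exact_mod_cast hN1
  have hs' : -s < 1 := by linarith
  have hlam' : (lambdaBar a Λ (-s) ω m (lamFlip a Λ s lam)).im = 0 := by
    rw [lambdaBar_lamFlip]; exact hlam
  exact hinj hoff (realAxis_vanishing_lt_one hsub ha hs' hω hω0 hlam' hthird hR' hin' hout')

/-! ### The real axis on the cosmological lattice -/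

/-- **Real axis, ON the lattice** (`s + 2B(r_c) = j ∈ ℕ`, `j + 1 ≤ N = 2s`; at a real frequency
this is the bottom stratum `j = s ∈ ℤ_{≥1}`, `Re ω = mϖ₂`): for `ω ∈ ℝ∖{0}`, `Im λ̄ = 0`,
`m = 0 ∨ ω/m ∉ (Ω_low, Ω_SR)` and `Re ω ≠ mϖ₁`, every generic-boundary radial Teukolsky solution of
spin `s` vanishes on `(r₊, r_c)`. The proof of `radial_vanishing_lattice` verbatim, with the flipped
solution killed by `realAxis_vanishing_lt_one` and the formal Euler partner by
`swappedRealAxisVanishing_holds`; `p₃` is automatic at `Re η_j = 0`. PROVED, 0 facts.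
[cite: CasalsTeixeiradacosta2022, Theorem 3.10 (second bullet), Corollary 3.9, proof Step 2 (Im ω = 0)] -/
theorem realAxis_vanishing_lattice {M a Λ s : ℝ} {ω : ℂ} {m : ℝ} {lam : ℂ} {R : ℝ → ℂ}
    (hsub : IsSubextremal M a Λ) (ha : 0 ≤ a) {N : ℕ} (hN1 : 1 ≤ N) (hsN : 2 * s = N)
    (hω : ω.im = 0) (hω0 : ω ≠ 0) (hlam : (lambdaBar a Λ s ω m lam).im = 0)
    (hthird : m = 0 ∨
      ¬(superradiantLower M a Λ < ω.re / m ∧ ω.re / m < superradiantUpper M a Λ))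
    (hray : ω.re ≠ m * horizonAngVel a (rPlus M a Λ))
    {j : ℕ} (hjN : j + 1 ≤ N) (hlat : (s : ℂ) + 2 * horizonB M a Λ ω m (rCosmo M a Λ) = (j : ℂ))
    (hR : IsRadialTeukolskySolution M a Λ s ω m lam R) (hin : IsIngoingAtEventHorizon M a Λ s ω m R)
    (hout : IsOutgoingAtCosmoHorizon M a Λ ω m R) :
    ∀ r ∈ Ioo (rPlus M a Λ) (rCosmo M a Λ), R r = 0 := by
  -- (0) the spin-flip image vanishes by route W; the Hatsuda function is `x^{1−γ}(z_r−x)^{1−ε}·r`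
  obtain ⟨R', hR', hin', hout', hpoly⟩ :=
    spinFlip_polynomial M a Λ s ω m lam R N hsub hN1 hsN hR hin hout
  have hN' : (1 : ℝ) ≤ N := by exact_mod_cast hN1
  have hs' : -s < 1 := by linarith
  have hlam' : (lambdaBar a Λ (-s) ω m (lamFlip a Λ s lam)).im = 0 := by
    rw [lambdaBar_lamFlip]; exact hlam
  have hR'0 := realAxis_vanishing_lt_one hsub ha hs' hω hω0 hlam' hthird hR' hin' hout'
  -- Prop. 3.8's pair condition `p₃` is automatic at a real frequency (`Re η_j = 0`)
  have hp₃ : PairCondition (-2 * (etaEvent M a Λ ω m + etaCauchy M a Λ ω m)) := by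
    intro _
    simp [Complex.mul_re, etaEvent_re, etaCauchy_re, hω]
  obtain ⟨r, hrdeg, hyr⟩ := hpoly hR'0 j hjN hlat
  -- abbreviations
  set η₀ := etaCauchy M a Λ ω m with hη₀
  set η₁ := etaEvent M a Λ ω m with hη₁
  set η₂ := etaCosmo M a Λ ω m with hη₂
  set z₂ := zTwo M a Λ with hz₂def
  set zr := mobiusZr M a Λ with hzrdef
  have hz₂ : 1 < z₂ := one_lt_zTwo hsub
  have hzr1 : 1 < zr := one_lt_mobiusZr hsub
  have hzr0 : 0 < zr := by linarith
  have hA' : zr / (zr - 1) = z₂ := mobiusA_mobiusZr hsub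
  set D : ℕ := N - 1 - j with hDdef
  have hDj : D + j + 1 = N := by omega
  have hrD : r.natDegree ≤ D := by omega
  set y : ℝ → ℂ := fun x => R (mobiusInv M a Λ x) / heunWeight M a Λ s ω m (mobiusInv M a Λ x)
    with hy
  -- (1) the Euler-gauge equation for `v = z^{−σ₋} y(z_r(z−1)/z)` on `(1, z₂)`
  have hysol := heunSolution_of_isRadialTeukolskySolution hsub hR
  have hV : ∀ z ∈ Ioo 1 z₂, 0 < z ∧ mobiusX zr z ∈ Ioo (0 : ℝ) 1 := by
    intro z hz
    obtain ⟨hz1, hzz⟩ := hz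
    have hz0 : 0 < z := by linarith
    refine ⟨hz0, ?_, ?_⟩
    · unfold mobiusX
      exact div_pos (mul_pos hzr0 (by linarith)) hz0
    · unfold mobiusX
      rw [div_lt_one hz0]
      rw [← hA'] at hzz
      have h1 : z * (zr - 1) < zr := (lt_div_iff₀ (by linarith)).mp hzz
      nlinarith
  have hmob := isSolutionOn_mobius (heun_fuchs hsub s ω m) (ne_of_gt hzr1) hV hysol
  rw [accessoryIdentity_holds M a Λ s ω m lam hsub, mobiusβ_eq hsub, mobiusγ_eq hsub,
    heunGamma_eq hsub, heunDelta_eq hsub, heunSigmaMinus_eq hsub, hzrdef, mobiusA_mobiusZr hsub]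
    at hmob
  -- the Euler-gauge parameters
  set m₁ := mass₁ M a Λ s ω m with hm₁
  set m₂ := mass₂ M a Λ ω m with hm₂
  set m₃ := mass₃ M a Λ s ω m with hm₃
  set m₄ := mass₄ M a Λ ω m with hm₄
  set E := bigE M a Λ s ω m lam with hE
  set ρ : ℂ := 2 * η₁ - (s : ℂ) with hρdef
  set η : ℂ := eulerGaugeα m₂ m₃ with hηdef
  have hF := eulerGauge_fuchs m₁ m₂ m₃ m₄
  have hroot : (η - eulerGaugeα m₂ m₃) * (η - eulerGaugeβ m₂ m₄) = 0 := by rw [hηdef]; ring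
  have hρ : ρ = 1 - eulerGaugeδ m₁ m₂ := by
    rw [hm₁, hm₂]; unfold mass₁ mass₂; rw [eulerGaugeδ_eta]; ring
  have hηval : η = 1 + (s : ℂ) + 2 * η₀ := by
    rw [hηdef, hm₂, hm₃]; unfold mass₂ mass₃; rw [eulerGaugeα_eta]
  -- (2) the explicit Frobenius-polynomial form of `v` on `(1, z₂)`
  set c₀ : ℂ := eulerKernel (heunGamma M a Λ s ω m + heunEps M a Λ s ω m - 2) zr with hc₀
  set A : Polynomial ℂ := shiftPoly zr D r with hAdef
  set aC : ℕ → ℂ := fun k => c₀ * A.coeff k with haC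
  have hAdeg : A.natDegree ≤ D := shiftPoly_natDegree_le zr D r
  have hκ : heunGamma M a Λ s ω m + heunEps M a Λ s ω m - 2 - heunSigmaMinus M a Λ s ω m = (D : ℂ) := by
    have hFH := heun_fuchs hsub s ω m
    have hσ : heunSigmaPlus s = (N : ℂ) + 1 := by
      have := two_sub_sigmaPlus s hsN; linear_combination -this
    have hδ : heunDelta M a Λ s ω m = (j : ℂ) + 1 := by
      have := delta_sub_one M a Λ s ω m; rw [hlat] at this; linear_combination this
    have hDc : (D : ℂ) = (N : ℂ) - 1 - (j : ℂ) := by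
      have : ((D + j + 1 : ℕ) : ℂ) = (N : ℂ) := by rw [hDj]
      push_cast at this; linear_combination this
    rw [hDc]; linear_combination hFH + hσ - hδ
  have hκ' : heunGamma M a Λ s ω m + heunEps M a Λ s ω m - 2 - η = (D : ℂ) := by
    rw [hηdef, hm₂, hm₃, ← heunSigmaMinus_eq hsub s ω m]; exact hκ
  have hγρ : 1 - heunGamma M a Λ s ω m = ρ := by rw [hρdef, hη₁]; exact one_sub_heunGamma hsub s ω m
  have hv_eq : ∀ w ∈ Ioo 1 z₂, mobiusV zr η y w = cpowSum ρ aC (D + 1) w := by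
    intro w hw
    obtain ⟨-, hx⟩ := hV w hw
    rw [mobiusV_eq_cpow_mul_eval hzr0 hrD hκ' hyr hw.1 hx, hγρ]
    exact cpow_mul_eval_eq_cpowSum hAdeg c₀ ρ hw.1
  have hsolF : IsSolutionOn (z₂ : ℂ) (eulerGaugeα m₂ m₃) (eulerGaugeβ m₂ m₄) (eulerGaugeγ m₁ m₂)
      (eulerGaugeδ m₁ m₂) (eulerGaugeε m₃ m₄) (eulerGaugeQ m₁ m₂ m₃ m₄ E (z₂ : ℂ)) (Ioo 1 z₂)
      (cpowSum ρ aC (D + 1)) :=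
    SpinFlipTS.IsSolutionOn.congr_eqOn isOpen_Ioo hmob fun w hw => hv_eq w hw
  -- (3) the formal Euler partner solves the swapped equation
  have haC0 : ∀ k, D < k → aC k = 0 := by
    intro k hk
    simp only [haC]
    rw [coeff_eq_zero_of_natDegree_lt (lt_of_le_of_lt hAdeg hk), mul_zero]
  set b : ℕ → ℂ := partnerCoeff ρ η D aC with hbdef
  set ρt : ℂ := 2 * (η₀ + η₁) with hρt
  have hρt' : ρ + η - 1 = ρt := by rw [hηval, hρdef, hρt]; ring
  have hpart := isSolutionOn_partner hz₂ hF hroot hρ haC0 hsolF z₂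
  rw [hηdef, euler_swap_α, euler_swap_β, euler_swap_γ, euler_swap_δ, euler_swap_ε, euler_swap_q,
    ← hηdef, hρt'] at hpart
  -- (4) mode data of the partner, gauge glue, energy identity
  have hdata := heunModeData_cpowSum hz₂ hpart
  obtain ⟨Rt, hRt, hRtinj⟩ := gaugeGlue_holds z₂ m₁ m₃ m₂ m₄ E ρt _ hz₂ hdata
  have he₁ : ρt + eulerGaugeδ m₁ m₃ / 2 = 1 / 2 + etaCauchy M a Λ ω m + etaEvent M a Λ ω m := by
    rw [hm₁, hm₃]; unfold mass₁ mass₃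
    rw [eulerGaugeδ_swap_eta, hρt, hη₀, hη₁]
    ring
  have he₂ : eulerGaugeε m₂ m₄ / 2 = 1 / 2 - etaCauchy M a Λ ω m - etaCosmo M a Λ ω m := by
    rw [hm₂, hm₄]; unfold mass₂ mass₄
    rw [eulerGaugeε_swap_eta]
    ring
  rw [he₁, he₂] at hRt
  have hsub' := hsub
  obtain ⟨hM, hΛ, h01, h12, -⟩ := hsub'
  have hr₀ : 0 ≤ rMinus M a Λ := rMinus_nonneg M a Λ
  have hcoef : ∀ z ∈ Ioo 1 z₂,
      sqcdCoeff m₁ m₃ m₂ m₄ E (z₂ : ℂ) z = tildeCoeff M a Λ s ω m lam z := by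
    intro z hz
    obtain ⟨hz1, hzz⟩ := hz
    rw [hm₁, hm₂, hm₃, hm₄, hE]
    unfold tildeCoeff bigE mass₁ mass₂ mass₃ mass₄
    rw [hz₂def] at hzz ⊢
    unfold zTwo
    symm
    refine ctdcTilde_eq_sqcd_swap (s : ℂ) η₀ η₁ η₂ (ltBlock M a Λ s ω m lam) ?_ ?_ ?_ ?_ ?_ ?_ ?_
    · exact_mod_cast (sub_pos.mpr h01).ne'
    · have : 0 < rCosmo M a Λ + (rMinus M a Λ + rPlus M a Λ + rCosmo M a Λ) := by linarith
      exact_mod_cast this.ne'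
    · have : 0 < rPlus M a Λ + rCosmo M a Λ := by linarith
      exact_mod_cast this.ne'
    · have : (0 : ℝ) < z := by linarith
      exact_mod_cast this.ne'
    · exact sub_ne_zero.mpr (by exact_mod_cast (ne_of_gt hz1))
    · unfold zTwo at hzz
      exact sub_ne_zero.mpr (by exact_mod_cast (ne_of_gt hzz))
    · rw [hz₂def] at hz₂
      unfold zTwo at hz₂
      have : (0 : ℝ) < ctdcZ₂ (rMinus M a Λ) (rPlus M a Λ) (rCosmo M a Λ) := by linarith
      exact_mod_cast this.ne'
  have hRt' : NormalFormModeData z₂ (tildeCoeff M a Λ s ω m lam)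
      (1 / 2 + etaCauchy M a Λ ω m + etaEvent M a Λ ω m)
      (1 / 2 - etaCauchy M a Λ ω m - etaCosmo M a Λ ω m) Rt := hRt.congr hcoef
  have hRt0 := swappedRealAxisVanishing_holds M a Λ s ω m lam Rt hsub ha hω hω0 hlam hthird hRt'
  have hvt0 : ∀ w ∈ Ioo 1 z₂, cpowSum ρt b (D + 1) w = 0 := hRtinj hRt0
  -- (5) `b ≡ 0`, the weights do not vanish, `a ≡ 0`
  have hb0 := coeff_eq_zero_of_cpowSum_eq_zero hz₂ hvt0
  have hκ₁ := surfaceGravity_rPlus_pos hsub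
  have h1 : ∀ i : ℕ, ρ + 1 + i ≠ 0 := by
    intro i h
    have him := congrArg Complex.im h
    simp only [hρdef, Complex.add_im, Complex.sub_im, Complex.mul_im, Complex.ofReal_im,
      Complex.natCast_im, Complex.one_im, Complex.zero_im, hη₁, etaEvent_im,
      Complex.re_ofNat, Complex.im_ofNat] at him
    have : ω.re - m * horizonAngVel a (rPlus M a Λ) = 0 := by
      have h2 : (2 : ℝ) * surfaceGravity M a Λ (rPlus M a Λ) ≠ 0 := by positivity
      field_simp at him
      linarith
    exact hray (sub_eq_zero.mp this)
  have h2 : ∀ i : ℕ, ρ + η + i ≠ 0 := by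
    intro i h
    have hnr := nonres_of_pairCondition (η₀ := η₀) (η₁ := η₁) (by rw [hη₀, hη₁]; exact hp₃) i
    apply hnr
    rw [hηval, hρdef] at h
    linear_combination h
  have ha0 : ∀ k, aC k = 0 := by
    intro k
    by_cases hk : k < D + 1
    · exact eq_zero_of_partnerCoeff_eq_zero h1 h2 (hb0 k hk)
    · exact haC0 k (by omega)
  -- (6) `v ≡ 0` on `(1, z₂)`, hence `R ≡ 0` on `(r₊, r_c)`
  have hv0 : ∀ w ∈ Ioo 1 z₂, mobiusV zr η y w = 0 := by
    intro w hw
    rw [hv_eq w hw]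
    unfold cpowSum
    exact sum_eq_zero fun k _ => by rw [ha0 k, zero_mul]
  intro rr hr
  have hx := mobiusZ_mem_Ioo hsub hr
  set x := mobiusZ M a Λ rr with hxdef
  obtain ⟨hx0, hx1⟩ := hx
  have hzx : 0 < zr - x := by linarith
  have hw1 : 1 < zr / (zr - x) := by rw [lt_div_iff₀ hzx]; linarith
  have hw2 : zr / (zr - x) < z₂ := by
    rw [← hA', div_lt_div_iff_of_pos_left hzr0 hzx (by linarith)]
    linarith
  have hX : mobiusX zr (zr / (zr - x)) = x := by
    unfold mobiusX
    field_simp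
    ring
  have h0 := hv0 _ ⟨hw1, hw2⟩
  simp only [mobiusV] at h0
  rw [hX] at h0
  rcases mul_eq_zero.mp h0 with hk | hyx
  · exact absurd hk (eulerKernel_ne_zero _ _)
  · have hrm : rr ≠ rMinus M a Λ := by
      intro h; rw [h] at hr; exact absurd hr.1 (by linarith)
    have hinv := mobiusInv_mobiusZ hsub hrm
    simp only [hy, hxdef] at hyx
    rw [hinv] at hyx
    rcases div_eq_zero_iff.mp hyx with hR0 | hw0
    · exact hR0
    · exact absurd hw0 (heunWeight_ne_zero hsub s ω m hr)

end RouteW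

end Summit.Ventures.KdS

end
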